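import Mathlib
import Summits.NavierStokesRegularity.NavierStokesRegularity.Theorems.PoloidalWindowDoorPoloidalWindowRigidityCriticalProduction
import Summits.NavierStokesRegularity.NavierStokesRegularity.Theorems.LerayQuarterDissipationFiniteDissipationLiouvilleEndpointScheme
import Literature.Analysis.FluidPDE.CKNInterpolationEstimate
import Literature.Analysis.FluidPDE.JiaSverak2013Lemma8SliceTools
import HarnessLib

/-!
# Route `LerayQuarterDissipation`, crux `FiniteDissipationLiouville` (stmt-NavierStokesRegularity-22144), line `birth` —
# CRITICAL PRODUCTION WITH A SUB-UNIT PALINSTROPHY CREDIT: `(−t)(⟪ω, Dv ω⟫ − a|∇ω|²_F) ≤ |ω|²`, `a < 1`, forces `v ≡ 0`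

Seat ns-lqd-lead g18 (LEAD of 22144, cell ns-idea-3; helper `--supports` 22144).  The tree's K2 row
`…PoloidalWindowRigidityCriticalProduction.eq_zero_of_critical_production` (nsreg-p7 g5) says: a profile of the
KNSS Type-I class whose enstrophy production never exceeds the CRITICAL RATE, `(−t)⟪ω, Dv ω⟫ ≤ |ω|²` everywhere, is
trivial (enstrophy hot spot + parabolic strong maximum principle for `Q = t²|ω|²`).  The exact balance
`∂ₜQ + DQ(v) − ΔQ = 2t|ω|² + t²(2⟪ω, Dv ω⟫ − 2|∇ω|²_F)` (`…EnstrophyHotSpot.weightedEnstrophy_identity`) carries a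
dissipation `−2t²|∇ω|²_F` of which that row uses nothing for the sub-solution property and everything for the rigidity
of the extremal.  Splitting it:

* `eq_zero_of_critical_production_credit` — **for every `a < 1`: a profile `V ∈ 𝔓(C)` (`IsTypeIAncientMild C V`, no
  envelope, no law) with `(−t)(⟪ω, DV ω⟫ − a |∇ω|²_F) ≤ |ω|²` at every point of `t < 0` vanishes identically.**  The
  production may exceed the critical rate by the fraction `a` of the local palinstrophy density.  `Q` is still a
  sub-solution, with dissipation `−2(1−a)t²|∇ω|²_F`; the hot-spot normal form needs the hypothesis to be closed under
  the class limits, which now involve SECOND derivatives — supplied by re-extracting a KNSS-convergent subsequence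
  (`…Compactness.seqLimit`, uniform convergence on slab pieces ⇒ `∇curl` converges, `…EndpointScheme.tendsto_fderiv_curl_of_unif`)
  and identifying the limits (`critProdCredit_of_limit`); the strong maximum principle then kills `(1−a)|∇ω_W|²_F` on
  a slab of the extremal `W`, whose vorticity slice is constant, hence `W ≡ 0` (`eq_zero_of_curl_translate_eq_slice`) —
  against `|curl W(−1,0)|² = M > 0`.
* `eq_zero_of_critical_production'` — the row `a = 0` in the vocabulary `IsTypeIAncientMild` (re-export).
* PORTRAIT `production_exceeds_credit_of_ne_zero` / `_of_singular` — a non-zero (a fortiori a singular) profile of the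
  class has, for every `a < 1`, a point with `(−t)(⟪ω, DV ω⟫ − a|∇ω|²_F) > |ω|²`.
* The borderline `a = 1` is exactly «`Q = t²|ω|²` is a sub-solution»; its extremals are the profiles with
  `|ω(t, ·)| ≡ √M/(−t)` — NOT excluded here (census).

Compare the line's stretching-form local enstrophy balance (`…LocalBalanceStretching`, enveloped class):
`⟪ω, DV ω⟫ ≤ |∇ω|²_F + |ω|²/(4(−t))` everywhere ⇒ `V ≡ 0` (`a = 1`, rate `¼`); the present row trades the full
palinstrophy credit for the full critical rate and drops the envelope.  WHAT THIS IS NOT: not a claim about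
Navier–Stokes regularity and not the crux — a settled stratum of the portrait of the hypothetical minimal ancient
element (bears_on LADDER-NS N0).
-/

noncomputable section

-- the summit and its single sub-problem share the name (CONVENTIONS §1), as in every Theorems file
set_option linter.dupNamespace false

namespace Summit.NavierStokesRegularity.NavierStokesRegularity.Theorems.FiniteDissipationLiouville.CriticalProduction

open MeasureTheory Set Function Filter Topology TopologicalSpace Metric InnerProductSpace
open scoped RealInnerProductSpace InnerProductSpace Laplacian ContDiff
open Literature.Analysis Literature.Analysis.FluidPDE
open Summit.NavierStokesRegularity.NavierStokesRegularity.Theorems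
open Summit.NavierStokesRegularity.NavierStokesRegularity.Theorems.LocalSineTubeDoorProfileAlignedWindowRigidityAncient
open Summit.NavierStokesRegularity.NavierStokesRegularity.Theorems.PoloidalWindowDoorPoloidalWindowRigidityWindow
open Summit.NavierStokesRegularity.NavierStokesRegularity.Theorems.PoloidalWindowDoorPoloidalWindowRigidityDegenerate
open Summit.NavierStokesRegularity.NavierStokesRegularity.Theorems.PoloidalWindowDoorPoloidalWindowRigidityFlat
open Summit.NavierStokesRegularity.NavierStokesRegularity.Theorems.PoloidalWindowDoorPoloidalWindowRigidityStrainRate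
open Summit.NavierStokesRegularity.NavierStokesRegularity.Theorems.PoloidalWindowDoorPoloidalWindowRigidityPoloidalExtremal
open Summit.NavierStokesRegularity.NavierStokesRegularity.Theorems.PoloidalWindowDoorPoloidalWindowRigidityEnstrophyHotSpot
open Summit.NavierStokesRegularity.NavierStokesRegularity.Theorems.PoloidalWindowDoorPoloidalWindowRigidityStrongMaxPrinciple
open Summit.NavierStokesRegularity.NavierStokesRegularity.Theorems.PoloidalWindowDoorPoloidalWindowRigidityVorticityTranslate
open Summit.NavierStokesRegularity.NavierStokesRegularity.Theorems.PoloidalWindowDoorPoloidalWindowRigidityCriticalProduction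
open Summit.NavierStokesRegularity.NavierStokesRegularity.Theorems.FiniteDissipationLiouville.EndpointScheme

variable {C : ℝ} {V : ℝ → EuclideanSpace ℝ (Fin 3) → EuclideanSpace ℝ (Fin 3)}

/-! ### «Production at most critical plus `a` palinstrophy» is preserved by the symmetries and the limits of the class -/

/-- Translation invariance of «`(−t)(production − a·palinstrophy density) ≤ |ω|²`». [folklore] -/
theorem critProdCredit_translate {a : ℝ} {u : ℝ → EuclideanSpace ℝ (Fin 3) → EuclideanSpace ℝ (Fin 3)}
    (x₀ : EuclideanSpace ℝ (Fin 3))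
    (h : ∀ s < 0, ∀ y, (-s) * (⟪curl (u s) y, fderiv ℝ (u s) y (curl (u s) y)⟫_ℝ
        - a * frobeniusNormSq (fderiv ℝ (curl (u s)) y)) ≤ ⟪curl (u s) y, curl (u s) y⟫_ℝ) :
    ∀ s < 0, ∀ y, (-s) * (⟪curl (fun x => u s (x₀ + x)) y,
        fderiv ℝ (fun x => u s (x₀ + x)) y (curl (fun x => u s (x₀ + x)) y)⟫_ℝ
        - a * frobeniusNormSq (fderiv ℝ (curl (fun x => u s (x₀ + x))) y)) ≤
      ⟪curl (fun x => u s (x₀ + x)) y, curl (fun x => u s (x₀ + x)) y⟫_ℝ := by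
  intro s hs y
  have e : curl (fun x => u s (x₀ + x)) = fun x => curl (u s) (x₀ + x) := funext fun x => curl_translate _ _ _
  rw [e, fderiv_translate, fderiv_translate]
  exact h s hs (x₀ + y)

/-- Scaling invariance of «`(−t)(production − a·palinstrophy density) ≤ |ω|²` (`nsRescale c`, `c > 0`: every term
picks up `c⁴` after `s ↦ c² s`). [folklore] -/
theorem critProdCredit_nsRescale {a : ℝ} {u : ℝ → EuclideanSpace ℝ (Fin 3) → EuclideanSpace ℝ (Fin 3)} {c : ℝ}
    (hc : 0 < c)
    (h : ∀ s < 0, ∀ y, (-s) * (⟪curl (u s) y, fderiv ℝ (u s) y (curl (u s) y)⟫_ℝ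
        - a * frobeniusNormSq (fderiv ℝ (curl (u s)) y)) ≤ ⟪curl (u s) y, curl (u s) y⟫_ℝ) :
    ∀ s < 0, ∀ y, (-s) * (⟪curl (nsRescale c u s) y,
        fderiv ℝ (nsRescale c u s) y (curl (nsRescale c u s) y)⟫_ℝ
        - a * frobeniusNormSq (fderiv ℝ (curl (nsRescale c u s)) y)) ≤
      ⟪curl (nsRescale c u s) y, curl (nsRescale c u s) y⟫_ℝ := by
  intro s hs y
  have hc2 : 0 < c ^ 2 := pow_pos hc 2
  have key := h (c ^ 2 * s) (mul_neg_of_pos_of_neg hc2 hs) (c • y)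
  rw [curl_nsRescale_slice, fderiv_nsRescale_slice, fderiv_curl_nsRescale, frobeniusNormSq_smul_eq]
  simp only [smul_apply, map_smul, real_inner_smul_left, real_inner_smul_right]
  have hc4 : 0 ≤ c ^ 2 * c ^ 2 := by positivity
  have e6 : (c * c * c) ^ 2 = c ^ 2 * (c ^ 2 * c ^ 2) := by ring
  rw [e6]
  have h2 := mul_le_mul_of_nonneg_left key hc4
  have e7 : -s * (c ^ 2 * (c ^ 2 * (c ^ 2 * ⟪curl (u (c ^ 2 * s)) (c • y),
        (fderiv ℝ (u (c ^ 2 * s)) (c • y)) (curl (u (c ^ 2 * s)) (c • y))⟫_ℝ)) -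
        a * (c ^ 2 * (c ^ 2 * c ^ 2) * frobeniusNormSq (fderiv ℝ (curl (u (c ^ 2 * s))) (c • y)))) =
      c ^ 2 * c ^ 2 * (-(c ^ 2 * s) * (⟪curl (u (c ^ 2 * s)) (c • y),
        (fderiv ℝ (u (c ^ 2 * s)) (c • y)) (curl (u (c ^ 2 * s)) (c • y))⟫_ℝ -
        a * frobeniusNormSq (fderiv ℝ (curl (u (c ^ 2 * s))) (c • y)))) := by ring
  have e8 : c ^ 2 * (c ^ 2 * ⟪curl (u (c ^ 2 * s)) (c • y), curl (u (c ^ 2 * s)) (c • y)⟫_ℝ) =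
      c ^ 2 * c ^ 2 * ⟪curl (u (c ^ 2 * s)) (c • y), curl (u (c ^ 2 * s)) (c • y)⟫_ℝ := by ring
  rw [e7, e8]
  exact h2

/-- **Closedness under the limits of the class.**  The hypothesis involves `∇ω`, i.e. second derivatives, while the
hot-spot normal form only hands over pointwise convergence of fields (and gradients); but every sequence of the class
has a KNSS-convergent subsequence (`…Compactness.seqLimit`: uniform convergence on the slab pieces, hence convergence
of `∇curl`, `…EndpointScheme.tendsto_fderiv_curl_of_unif`), whose limit agrees with the pointwise one on `t < 0`.
[cite: KochNadirashviliSereginSverak2009, Prop. 4.1 (arXiv:0709.3599)] -/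
theorem critProdCredit_of_limit {a : ℝ} {w : ℕ → ℝ → EuclideanSpace ℝ (Fin 3) → EuclideanSpace ℝ (Fin 3)}
    {W : ℝ → EuclideanSpace ℝ (Fin 3) → EuclideanSpace ℝ (Fin 3)}
    (hw : ∀ k, IsTypeIAncientMild C (w k))
    (h : ∀ k, ∀ s < 0, ∀ y, (-s) * (⟪curl (w k s) y, fderiv ℝ (w k s) y (curl (w k s) y)⟫_ℝ
        - a * frobeniusNormSq (fderiv ℝ (curl (w k s)) y)) ≤ ⟪curl (w k s) y, curl (w k s) y⟫_ℝ)
    (hpt : ∀ t < 0, ∀ x, Tendsto (fun j => w j t x) atTop (𝓝 (W t x))) :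
    ∀ s < 0, ∀ y, (-s) * (⟪curl (W s) y, fderiv ℝ (W s) y (curl (W s) y)⟫_ℝ
        - a * frobeniusNormSq (fderiv ℝ (curl (W s)) y)) ≤ ⟪curl (W s) y, curl (W s) y⟫_ℝ := by
  obtain ⟨ψ, hψ, W', hW', hunif', hpt', hgr'⟩ := Compactness.seqLimit hw
  intro s hs y
  -- the two limits agree on the slice `s`
  have e : W s = W' s := funext fun x =>
    tendsto_nhds_unique ((hpt s hs x).comp hψ.tendsto_atTop) (hpt' s hs x)
  rw [e]
  have hD : Tendsto (fun j => fderiv ℝ (w (ψ j) s) y) atTop (𝓝 (fderiv ℝ (W' s) y)) := hgr' s hs y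
  have hc : Tendsto (fun j => curl (w (ψ j) s) y) atTop (𝓝 (curl (W' s) y)) := tendsto_curl_of_fderiv hD
  have hG : Tendsto (fun j => fderiv ℝ (curl (w (ψ j) s)) y) atTop (𝓝 (fderiv ℝ (curl (W' s)) y)) :=
    tendsto_fderiv_curl_of_unif (fun j => hw (ψ j)) hW' hunif' hs y
  have happ : Tendsto (fun j => fderiv ℝ (w (ψ j) s) y (curl (w (ψ j) s) y)) atTop
      (𝓝 (fderiv ℝ (W' s) y (curl (W' s) y))) :=
    ((isBoundedBilinearMap_apply (𝕜 := ℝ) (E := EuclideanSpace ℝ (Fin 3))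
      (F := EuclideanSpace ℝ (Fin 3))).continuous.tendsto (fderiv ℝ (W' s) y, curl (W' s) y)).comp (hD.prodMk_nhds hc)
  have hF : Tendsto (fun j => frobeniusNormSq (fderiv ℝ (curl (w (ψ j) s)) y)) atTop
      (𝓝 (frobeniusNormSq (fderiv ℝ (curl (W' s)) y))) := (continuous_frobeniusNormSq'.tendsto _).comp hG
  have h1 : Tendsto (fun j => (-s) * (⟪curl (w (ψ j) s) y, fderiv ℝ (w (ψ j) s) y (curl (w (ψ j) s) y)⟫_ℝ
      - a * frobeniusNormSq (fderiv ℝ (curl (w (ψ j) s)) y))) atTop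
      (𝓝 ((-s) * (⟪curl (W' s) y, fderiv ℝ (W' s) y (curl (W' s) y)⟫_ℝ
        - a * frobeniusNormSq (fderiv ℝ (curl (W' s)) y)))) :=
    ((hc.inner happ).sub (hF.const_mul a)).const_mul (-s)
  have h2 : Tendsto (fun j => ⟪curl (w (ψ j) s) y, curl (w (ψ j) s) y⟫_ℝ) atTop
      (𝓝 ⟪curl (W' s) y, curl (W' s) y⟫_ℝ) := hc.inner hc
  exact le_of_tendsto_of_tendsto' h1 h2 fun j => h (ψ j) s hs y

/-! ### The stratum is empty -/

/-- **PROFILES WHOSE ENSTROPHY PRODUCTION EXCEEDS THE CRITICAL RATE BY LESS THAN A FIXED SUB-UNIT FRACTION OF THE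
PALINSTROPHY DENSITY ARE TRIVIAL.**  For `a < 1`: if `V ∈ 𝔓(C)` (`IsTypeIAncientMild C V`) satisfies
`(−s)(⟪ω, DV ω⟫ − a |∇ω|²_F)(s,y) ≤ |ω(s,y)|²` for all `s < 0`, `y`, then `V ≡ 0` on `t < 0`.  (`Q = t²|ω|²` is a
sub-solution with dissipation `2(1−a)t²|∇ω|²_F`; enstrophy hot spot; parabolic strong maximum principle; a constant
vorticity slice is excluded by the class.) [cite: KochNadirashviliSereginSverak2009, Prop. 4.1 and Lemma 3.1 (arXiv:0709.3599)] -/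
theorem eq_zero_of_critical_production_credit {a : ℝ} (ha : a < 1) (hV : IsTypeIAncientMild C V)
    (hprod : ∀ s < 0, ∀ y, (-s) * (⟪curl (V s) y, fderiv ℝ (V s) y (curl (V s) y)⟫_ℝ
        - a * frobeniusNormSq (fderiv ℝ (curl (V s)) y)) ≤ ⟪curl (V s) y, curl (V s) y⟫_ℝ) :
    ∀ t < 0, ∀ x, V t x = 0 := by
  -- adapted from Theorems/…PoloidalWindowRigidityCriticalProduction.lean (`eq_zero_of_critical_production`, nsreg-p7 g5)
  have hrate : HasTypeITimeDecay C V := hV.hasTypeITimeDecay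
  have hcont : ContinuousOn (uncurry V) (Iio (0 : ℝ) ×ˢ univ) := hV.continuousOn_uncurry
  have hmild : ∀ s t : ℝ, s < t → t < 0 → ∀ x,
      V t x = UnboundedOperators.heatExtension (V s) (t - s) x - oseenDuhamel 1 s V V t x :=
    fun s t hst ht x => hV.mild_eq_heatExtension hst ht x
  have hdiv : ∀ t < 0, VectorCalculus.IsDivFree (V t) := fun t ht => hV.isDivFree ht
  refine eq_zero_of_irrotational hrate hcont hmild hdiv fun s₀ hs₀ y₀ => ?_
  by_contra hne
  have ha1 : 0 < 1 - a := sub_pos.2 ha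
  -- ## the enstrophy hot spot inside the stratum
  obtain ⟨W, M, hW, hPW, hMpos, hle, hmax⟩ := exists_enstrophy_hotSpot
    (P := fun u => ∀ s < 0, ∀ y, (-s) * (⟪curl (u s) y, fderiv ℝ (u s) y (curl (u s) y)⟫_ℝ
        - a * frobeniusNormSq (fderiv ℝ (curl (u s)) y)) ≤ ⟪curl (u s) y, curl (u s) y⟫_ℝ)
    (fun u x₀ hu => critProdCredit_translate x₀ hu) (fun u c hc hu => critProdCredit_nsRescale hc hu)
    (fun w W' hw hPw _ hpt _ => critProdCredit_of_limit hw hPw hpt) hV hprod hs₀ hne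
  have hWrate : HasTypeITimeDecay C W := hW.hasTypeITimeDecay
  have hWcont : ContinuousOn (uncurry W) (Iio (0 : ℝ) ×ˢ univ) := hW.continuousOn_uncurry
  have hWmild : ∀ s t : ℝ, s < t → t < 0 → ∀ x,
      W t x = UnboundedOperators.heatExtension (W s) (t - s) x - oseenDuhamel 1 s W W t x :=
    fun s t hst ht x => hW.mild_eq_heatExtension hst ht x
  have hWdiv : ∀ t < 0, VectorCalculus.IsDivFree (W t) := fun t ht => hW.isDivFree ht
  -- ## the critically weighted enstrophy `Q = t² |ω|²` and its dissipation `2(1−a)t²|∇ω|²_F`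
  set q : ℝ → EuclideanSpace ℝ (Fin 3) → ℝ := fun τ y => ⟪curl (W τ) y, curl (W τ) y⟫_ℝ with hqdef
  set Q : ℝ → EuclideanSpace ℝ (Fin 3) → ℝ := fun τ y => τ ^ 2 * q τ y with hQdef
  set Qt : ℝ → EuclideanSpace ℝ (Fin 3) → ℝ := fun τ y => deriv (fun τ' => Q τ' y) τ with hQtdef
  set D : ℝ → EuclideanSpace ℝ (Fin 3) → ℝ := fun τ y =>
    2 * (1 - a) * τ ^ 2 * frobeniusNormSq (fderiv ℝ (curl (W τ)) y) with hDdef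
  have hg : ∀ τ < (0 : ℝ), HasDerivAt (fun τ : ℝ => τ ^ 2) (2 * τ) τ := fun τ _ => by
    simpa using hasDerivAt_pow 2 τ
  have hid := fun τ (hτ : τ < 0) y => weightedEnstrophy_identity hWrate hWcont hWmild hWdiv hg hτ y
  -- ## the slab `[−2, −1/2] × ℝ³`
  have hslab : ∀ t ∈ Icc (-2 : ℝ) (-1 / 2), t < 0 := fun t ht => by linarith [ht.2]
  obtain ⟨B, hB⟩ := bdd_of_hasTypeITimeDecay hWrate (1 / 4) (by norm_num)
  have hbA : ∀ t ∈ Icc (-2 : ℝ) (-1 / 2), ∀ x, ‖W t x‖ ≤ B := fun t ht x => hB t (by linarith [ht.2]) x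
  have hsmω : IsSmoothSpaceTimeOn (Iio 0) (vorticity W) :=
    (show IsSmoothSpaceTimeOn (Iio 0) W from hW.contDiffOn).isSmoothSpaceTimeOn_vorticity isOpen_Iio.uniqueDiffOn
  have hq_c : ContinuousOn (uncurry q) (Icc (-2 : ℝ) (-1 / 2) ×ˢ univ) := by
    have hωc : ContinuousOn (uncurry (vorticity W)) (Icc (-2 : ℝ) (-1 / 2) ×ˢ univ) :=
      hsmω.continuousOn.mono (prod_mono (fun t ht => hslab t ht) Subset.rfl)
    have h : ContinuousOn (fun z => ⟪uncurry (vorticity W) z, uncurry (vorticity W) z⟫_ℝ)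
        (Icc (-2 : ℝ) (-1 / 2) ×ˢ univ) := hωc.inner hωc
    refine h.congr fun z _ => ?_
    simp only [hqdef, uncurry, vorticity_apply]
  have hQ_c : ContinuousOn (uncurry Q) (Icc (-2 : ℝ) (-1 / 2) ×ˢ univ) := by
    have hg1 : ContinuousOn (fun z : ℝ × EuclideanSpace ℝ (Fin 3) => z.1 ^ 2) (Icc (-2 : ℝ) (-1 / 2) ×ˢ univ) :=
      (continuous_fst.pow 2).continuousOn
    refine (hg1.mul hq_c).congr fun z _ => ?_
    rcases z with ⟨a, b⟩
    rfl
  have hq2 : ∀ t < (0 : ℝ), ContDiff ℝ 2 (q t) := fun t ht => by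
    have hΩ : ContDiff ℝ 2 (curl (W t)) :=
      contDiff_curl (n := 2) (analyticOnNhd_slice hWcont (bdd_of_hasTypeITimeDecay hWrate) hWmild ht).contDiff
    exact hΩ.inner ℝ hΩ
  have hQ2 : ∀ t ∈ Icc (-2 : ℝ) (-1 / 2), ContDiff ℝ 2 (Q t) := fun t ht => by
    have h : ContDiff ℝ 2 (fun y => t ^ 2 * q t y) := contDiff_const.mul (hq2 t (hslab t ht))
    exact h
  have hQt : ∀ x, ∀ t ∈ Icc (-2 : ℝ) (-1 / 2), HasDerivAt (fun τ => Q τ x) (Qt t x) t :=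
    fun x t ht => (hid t (hslab t ht) x).1
  have hD0 : ∀ t ∈ Icc (-2 : ℝ) (-1 / 2), ∀ x, 0 ≤ D t x := fun t _ x => by
    simp only [hDdef]
    exact mul_nonneg (by positivity) (frobeniusNormSq_nonneg _)
  have hlawD : ∀ t ∈ Icc (-2 : ℝ) (-1 / 2), ∀ x,
      Qt t x + fderiv ℝ (Q t) x (W t x) - (Δ (Q t)) x ≤ -D t x := by
    intro t ht x
    have htn : t < 0 := hslab t ht
    have h := (hid t htn x).2
    have hP := hPW t htn x
    have h1 : t ^ 2 * ⟪curl (W t) x, fderiv ℝ (W t) x (curl (W t) x)⟫_ℝ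
        - a * t ^ 2 * frobeniusNormSq (fderiv ℝ (curl (W t)) x) ≤ (-t) * q t x := by
      have h2 := mul_le_mul_of_nonneg_left hP (neg_pos.2 htn).le
      simp only [hqdef]
      nlinarith [h2]
    simp only [hQtdef, hQdef, hDdef, hqdef] at h h1 ⊢
    rw [h]
    nlinarith [h1]
  have hle' : ∀ t ∈ Icc (-2 : ℝ) (-1 / 2), ∀ x, Q t x ≤ M := fun t ht x => by
    have h := hle t (hslab t ht) x
    rw [neg_sq] at h
    exact h
  have hmaxQ : Q (-1) 0 = M := by
    simp only [hQdef, hqdef, hmax]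
    norm_num
  have hts : (-1 : ℝ) ∈ Ioc (-2 : ℝ) (-1 / 2) := by constructor <;> norm_num
  have hdis := dissipation_eq_zero_of_max (t₀ := (-2 : ℝ)) (T := -1 / 2) hbA hQ_c hQ2 hQt hD0 hlawD hle' hts hmaxQ
  -- ## on the slice `s = −3/2` the vorticity gradient vanishes
  have hs₁ : (-3 / 2 : ℝ) ∈ Ioo (-2 : ℝ) (-1) := by constructor <;> norm_num
  have hF : ∀ x, fderiv ℝ (curl (W (-3 / 2))) x = 0 := by
    intro x
    have h := hdis (-3 / 2) hs₁ x
    have hfrob : frobeniusNormSq (fderiv ℝ (curl (W (-3 / 2))) x) = 0 := by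
      have h2 : (2 : ℝ) * (1 - a) * (-3 / 2) ^ 2 ≠ 0 := by positivity
      simp only [hDdef] at h
      exact (mul_eq_zero.1 h).resolve_left h2
    have hn : ‖fderiv ℝ (curl (W (-3 / 2))) x‖ ^ 2 ≤ 0 := by
      have h3 := sq_opNorm_le_frobeniusNormSq (fderiv ℝ (curl (W (-3 / 2))) x)
      rw [hfrob] at h3
      exact h3
    have hn0 : ‖fderiv ℝ (curl (W (-3 / 2))) x‖ = 0 := by
      nlinarith [norm_nonneg (fderiv ℝ (curl (W (-3 / 2))) x)]
    exact norm_eq_zero.1 hn0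
  -- so `curl W(−3/2, ·)` is constant, in particular translation-invariant along `e₀`
  have hΩd : Differentiable ℝ (curl (W (-3 / 2))) :=
    (contDiff_curl (n := 1) (analyticOnNhd_slice hWcont (bdd_of_hasTypeITimeDecay hWrate) hWmild
      (by norm_num)).contDiff).differentiable one_ne_zero
  have hconst : ∀ (y : EuclideanSpace ℝ (Fin 3)) (l : ℝ),
      curl (W (-3 / 2)) (y + l • EuclideanSpace.single 0 (1 : ℝ)) = curl (W (-3 / 2)) y :=
    fun y l => is_const_of_fderiv_eq_zero hΩd hF _ _
  have he : (EuclideanSpace.single (0 : Fin 3) (1 : ℝ) : EuclideanSpace ℝ (Fin 3)) ≠ 0 := fun h => by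
    simpa using congrArg (fun w : EuclideanSpace ℝ (Fin 3) => w 0) h
  have hW0 : ∀ t < 0, ∀ x, W t x = 0 :=
    eq_zero_of_curl_translate_eq_slice hWrate hWcont hWmild hWdiv (by norm_num : (-3 / 2 : ℝ) < 0) he hconst
  -- ## contradiction: `|curl W(−1,0)|² = M > 0`
  have hc0 : curl (W (-1)) 0 = 0 := by
    have hslice : W (-1) = fun _ => 0 := funext fun x => hW0 (-1) (by norm_num) x
    rw [curl_eq_curlCLM, hslice]
    simp
  rw [hc0, inner_zero_left] at hmax
  exact absurd hmax hMpos.ne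

/-- The K2 row `a = 0` in the vocabulary of this line: a profile `V ∈ 𝔓(C)` with `(−s)⟪ω, DV ω⟫ ≤ |ω|²` everywhere
vanishes (`…CriticalProduction.eq_zero_of_critical_production`, re-exported for `IsTypeIAncientMild`).
[cite: KochNadirashviliSereginSverak2009, Prop. 4.1 (arXiv:0709.3599)] -/
theorem eq_zero_of_critical_production' (hV : IsTypeIAncientMild C V)
    (hprod : ∀ s < 0, ∀ y, (-s) * ⟪curl (V s) y, fderiv ℝ (V s) y (curl (V s) y)⟫_ℝ ≤
      ⟪curl (V s) y, curl (V s) y⟫_ℝ) :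
    ∀ t < 0, ∀ x, V t x = 0 :=
  eq_zero_of_critical_production hV.hasTypeITimeDecay hV.continuousOn_uncurry
    (fun _ _ hst ht x => hV.mild_eq_heatExtension hst ht x) (fun _ ht => hV.isDivFree ht) hprod

/-! ### Portrait clauses -/

/-- **PORTRAIT: the production of a non-zero profile exceeds the critical rate plus any sub-unit palinstrophy
credit somewhere.**  `V ∈ 𝔓(C)` not identically zero on `t < 0`, `a < 1` ⇒ there is a point `(s, y)`, `s < 0`, with
`|ω|² < (−s)(⟪ω, DV ω⟫ − a|∇ω|²_F)`. [cite: KochNadirashviliSereginSverak2009, Prop. 4.1 (arXiv:0709.3599)] -/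
theorem production_exceeds_credit_of_ne_zero {a : ℝ} (ha : a < 1) (hV : IsTypeIAncientMild C V)
    (hne : ∃ t : ℝ, t < 0 ∧ ∃ x, V t x ≠ 0) :
    ∃ s : ℝ, s < 0 ∧ ∃ y : EuclideanSpace ℝ (Fin 3),
      ⟪curl (V s) y, curl (V s) y⟫_ℝ < (-s) * (⟪curl (V s) y, fderiv ℝ (V s) y (curl (V s) y)⟫_ℝ
        - a * frobeniusNormSq (fderiv ℝ (curl (V s)) y)) := by
  by_contra h
  push Not at h
  obtain ⟨t, ht, x, hx⟩ := hne
  exact hx (eq_zero_of_critical_production_credit ha hV (fun s hs y => h s hs y) t ht x)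

/-- **PORTRAIT (singular form).**  A profile `V ∈ 𝔓(C)` singular at the space-time origin has, for every `a < 1`, a
point with `|ω|² < (−s)(⟪ω, DV ω⟫ − a|∇ω|²_F)`. [cite: KochNadirashviliSereginSverak2009, Prop. 4.1 (arXiv:0709.3599)] -/
theorem production_exceeds_credit_of_singular {a : ℝ} (ha : a < 1) (hV : IsTypeIAncientMild C V)
    (hsing : ∀ r > 0, ∀ M : ℝ, ∃ t ∈ Ioo (-(r ^ 2)) (0 : ℝ),
        ∃ x ∈ ball (0 : EuclideanSpace ℝ (Fin 3)) r, M < ‖V t x‖) :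
    ∃ s : ℝ, s < 0 ∧ ∃ y : EuclideanSpace ℝ (Fin 3),
      ⟪curl (V s) y, curl (V s) y⟫_ℝ < (-s) * (⟪curl (V s) y, fderiv ℝ (V s) y (curl (V s) y)⟫_ℝ
        - a * frobeniusNormSq (fderiv ℝ (curl (V s)) y)) := by
  refine production_exceeds_credit_of_ne_zero ha hV ?_
  obtain ⟨t, ht, x, -, hM⟩ := hsing 1 one_pos 0
  exact ⟨t, ht.2, x, fun h0 => by rw [h0, norm_zero] at hM; exact lt_irrefl _ hM⟩

end Summit.NavierStokesRegularity.NavierStokesRegularity.Theorems.FiniteDissipationLiouville.CriticalProduction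

end
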